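import Summits.AtomisticToContinuum.FouriersLaw.Theorems.EmbeddedDrudeMourreFGRGapEssGapG

/-!
# `FGRGap`, line fold-jet-rigidity, stub `stub_oddEssentialGap` — part H: assembly

Helper file for the crux `Summit.AtomisticToContinuum.FouriersLaw.Theses.EmbeddedDrudeMourre.FGRGap`
(item `stmt-AtomisticToContinuum-12595`): the registered stub `stub_oddEssentialGap` itself.

From the local estimate of part G at every base momentum `x₀ ∈ [-π, π]` — `¼ · ofReal (c ∫_{I(x₀)} g² + X g)
≤ q(g)` with `X(g_n) → 0` along weakly-null sequences — a finite subcover `I(x₁), …, I(x_m)` of the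
compact cell closure gives, for a weakly-null sequence of unit vectors `f_n`,
`m · q(f_n) ≥ ¼ (c₀ Σ_j ∫_{I_j} f_n² - Σ_j |X_j f_n|) ≥ ¼ (c₀ - c₀/2)` eventually (`c₀ = min c_j`,
`Σ_j ∫_{I_j} f_n² ≥ ‖f_n‖²_{cell} = 1`), hence `liminf q(f_n) ≥ c₀ / (8m) > 0`. Folklore; no named facts.
-/

noncomputable section

open MeasureTheory Set Real Filter Topology
open scoped ENNReal
open Literature.MathematicalPhysics.KineticTheory.PhononBoltzmann

namespace Summit.AtomisticToContinuum.FouriersLaw.Theorems.FGRGap.FoldJetRigidity.EssGap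

/-- Every bounded interval `[x - r, x + r]` lies in some window `(-π - 2πN, π + 2πN]`. [folklore] -/
theorem Icc_subset_window (x r : ℝ) :
    ∃ N : ℕ, Icc (x - r) (x + r) ⊆ Ioc (-π - N * (2 * π)) (π + N * (2 * π)) := by
  obtain ⟨N, hN⟩ := exists_nat_ge (|x| + |r|)
  have hN0 : (0 : ℝ) ≤ N := N.cast_nonneg
  have h1 : (N : ℝ) ≤ N * (2 * π) := by nlinarith [Real.pi_gt_three]
  refine ⟨N, fun y hy => ⟨?_, ?_⟩⟩
  · linarith [hy.1, neg_abs_le x, le_abs_self r, pi_pos]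
  · linarith [hy.2, le_abs_self x, le_abs_self r, pi_pos]

/-- ASSEMBLY. If at every base momentum `x₀` there is a local coercivity estimate
`¼ · ofReal (c ∫_{[x₀-ε, x₀+ε]} g² + X g) ≤ q(g)` (`ε, c > 0`) on the unit ball of `2π`-periodic measurable
`g`, whose error `X` dies along weakly-null sequences, then `liminf q(f_n) ≥ v₀ > 0` along every
weakly-null sequence of odd unit vectors (compactness of `[-π, π]`: finitely many base points suffice,
and the local masses `∫_{I_j} f_n²` add up to at least `‖f_n‖² = 1`). [folklore] -/
theorem oddEssentialGap_of_local {ω₂ a b : ℝ}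
    (L : ∀ x₀ : ℝ, ∃ ε : ℝ, 0 < ε ∧ ∃ c : ℝ, 0 < c ∧ ∃ X : (ℝ → ℝ) → ℝ,
      (∀ g : ℝ → ℝ, Function.Periodic g (2 * π) → Measurable g → cellNormSq g ≤ 1 →
        ENNReal.ofReal (1 / 4) * ENNReal.ofReal (c * (∫ x in Icc (x₀ - ε) (x₀ + ε), g x ^ 2) + X g) ≤
          boltzmannForm ω₂ a b g) ∧
      (∀ g : ℕ → ℝ → ℝ, (∀ n, Function.Periodic (g n) (2 * π)) → (∀ n, Measurable (g n)) →
        (∀ n, cellNormSq (g n) ≤ 1) →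
        (∀ φ : ℝ → ℝ, Measurable φ → cellNormSq φ < ∞ →
          Tendsto (fun n => cellPairing φ (g n)) atTop (𝓝 0)) →
        Tendsto (fun n => X (g n)) atTop (𝓝 0))) :
    ∃ v₀ : ℝ, 0 < v₀ ∧
      ∀ f : ℕ → ℝ → ℝ, (∀ n, Function.Periodic (f n) (2 * π)) → (∀ n, Measurable (f n)) →
        (∀ n, Function.Odd (f n)) → (∀ n, cellNormSq (f n) = 1) →
          (∀ φ : ℝ → ℝ, Measurable φ → cellNormSq φ < ∞ →
              Filter.Tendsto (fun n => cellPairing φ (f n)) Filter.atTop (nhds 0)) →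
            ENNReal.ofReal v₀ ≤ Filter.liminf (fun n => boltzmannForm ω₂ a b (f n)) Filter.atTop := by
  classical
  -- two finite subadditivity facts (kept proof-local)
  have ofReal_sum_le : ∀ (s : Finset ℝ) (F : ℝ → ℝ),
      ENNReal.ofReal (∑ i ∈ s, F i) ≤ ∑ i ∈ s, ENNReal.ofReal (F i) := by
    intro s F
    induction s using Finset.induction_on with
    | empty => simp
    | insert i s hi ih =>
      rw [Finset.sum_insert hi, Finset.sum_insert hi]
      exact ENNReal.ofReal_add_le.trans (add_le_add le_rfl ih)
  have lintegral_biUnion_finset_le : ∀ (s : Finset ℝ) (S : ℝ → Set ℝ) (F : ℝ → ℝ≥0∞),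
      ∫⁻ x in ⋃ i ∈ s, S i, F x ≤ ∑ i ∈ s, ∫⁻ x in S i, F x := by
    intro s S F
    induction s using Finset.induction_on with
    | empty => simp
    | insert i s hi ih =>
      rw [Finset.set_biUnion_insert, Finset.sum_insert hi]
      exact (lintegral_union_le _ _ _).trans (add_le_add le_rfl ih)
  choose ε hε c hc X hX1 hX2 using L
  -- a finite subcover of the compact cell closure by the open cores of the local intervals
  obtain ⟨t, ht⟩ : ∃ t : Finset ℝ, Icc (-π) π ⊆ ⋃ x ∈ t, Ioo (x - ε x) (x + ε x) :=
    isCompact_Icc.elim_finite_subcover (fun x => Ioo (x - ε x) (x + ε x)) (fun _ => isOpen_Ioo)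
      (fun y _ => mem_iUnion.2 ⟨y, ⟨by linarith [hε y], by linarith [hε y]⟩⟩)
  have htne : t.Nonempty := by
    have h0 : (0 : ℝ) ∈ ⋃ x ∈ t, Ioo (x - ε x) (x + ε x) := ht ⟨by linarith [pi_pos], pi_pos.le⟩
    simp only [mem_iUnion] at h0
    obtain ⟨x, hx, -⟩ := h0
    exact ⟨x, hx⟩
  have hm0 : (0 : ℝ) < t.card := Nat.cast_pos.2 htne.card_pos
  have hc₀ : 0 < t.inf' htne c := (Finset.lt_inf'_iff _).2 fun x _ => hc x
  have hc₀le : ∀ x ∈ t, t.inf' htne c ≤ c x := fun x hx => Finset.inf'_le _ hx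
  refine ⟨t.inf' htne c / (8 * t.card), div_pos hc₀ (mul_pos (by norm_num) hm0),
    fun f hper hfm _ hf1 hweak => ?_⟩
  have hf1' : ∀ n, cellNormSq (f n) ≤ 1 := fun n => (hf1 n).le
  -- eventually every error term is small
  have hev : ∀ᶠ n in atTop, ∀ x ∈ t, |X x (f n)| ≤ t.inf' htne c / (2 * t.card) := by
    refine (Filter.eventually_all_finset t).2 fun x _ => ?_
    have hpos : 0 < t.inf' htne c / (2 * t.card) := div_pos hc₀ (mul_pos (by norm_num) hm0)
    have h := Metric.tendsto_nhds.1 (hX2 x f hper hfm hf1' hweak) _ hpos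
    exact h.mono fun n hn => by rw [Real.dist_0_eq_abs] at hn; exact hn.le
  refine Filter.le_liminf_of_le (h := hev.mono fun n hn => ?_)
  -- names for the local masses of `f n`
  obtain ⟨A, hA⟩ : ∃ A : ℝ → ℝ, ∀ x, A x = ∫ y in Icc (x - ε x) (x + ε x), f n y ^ 2 :=
    ⟨_, fun _ => rfl⟩
  obtain ⟨B, hB⟩ : ∃ B : ℝ → ℝ≥0∞, ∀ x, B x = ∫⁻ y in Icc (x - ε x) (x + ε x),
      ENNReal.ofReal (f n y ^ 2) := ⟨_, fun _ => rfl⟩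
  have hX1' : ∀ x ∈ t, ENNReal.ofReal (1 / 4) * ENNReal.ofReal (c x * A x + X x (f n)) ≤
      boltzmannForm ω₂ a b (f n) := fun x _ => by
    rw [hA]; exact hX1 x (f n) (hper n) (hfm n) (hf1' n)
  -- the local masses are finite and add up to at least `‖f n‖² = 1`
  have hBlt : ∀ x, B x < ∞ := fun x => by
    obtain ⟨N, hN⟩ := Icc_subset_window x (ε x)
    rw [hB]
    refine lt_of_le_of_lt ((lintegral_mono_set hN).trans (lintegral_sq_window_le (hper n) N)) ?_
    rw [hf1 n, mul_one]
    exact ENNReal.add_lt_top.2 ⟨ENNReal.mul_lt_top (by simp) (by simp), ENNReal.one_lt_top⟩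
  have hAB : ∀ x, A x = (B x).toReal := fun x => by
    rw [hA, hB]
    exact integral_eq_lintegral_of_nonneg_ae (Eventually.of_forall fun y => sq_nonneg _)
      (((hfm n).pow_const 2).aestronglyMeasurable)
  have hcover : Ioc (-π) π ⊆ ⋃ x ∈ t, Icc (x - ε x) (x + ε x) := fun y hy => by
    have h := ht (Ioc_subset_Icc_self hy)
    simp only [mem_iUnion] at h ⊢
    obtain ⟨x, hx, hy'⟩ := h
    exact ⟨x, hx, Ioo_subset_Icc_self hy'⟩
  have hsumB : (1 : ℝ≥0∞) ≤ ∑ x ∈ t, B x := by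
    calc (1 : ℝ≥0∞) = cellNormSq (f n) := (hf1 n).symm
      _ ≤ ∫⁻ y in ⋃ x ∈ t, Icc (x - ε x) (x + ε x), ENNReal.ofReal (f n y ^ 2) :=
          lintegral_mono_set hcover
      _ ≤ ∑ x ∈ t, ∫⁻ y in Icc (x - ε x) (x + ε x), ENNReal.ofReal (f n y ^ 2) :=
          lintegral_biUnion_finset_le t _ _
      _ = ∑ x ∈ t, B x := Finset.sum_congr rfl fun x _ => (hB x).symm
  have hBne : ∀ x ∈ t, B x ≠ ∞ := fun x _ => (hBlt x).ne
  have hsumA : (1 : ℝ) ≤ ∑ x ∈ t, A x := by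
    have e : ∑ x ∈ t, A x = (∑ x ∈ t, B x).toReal := by
      rw [ENNReal.toReal_sum hBne]
      exact Finset.sum_congr rfl fun x _ => hAB x
    rw [e]
    exact (ENNReal.ofReal_le_iff_le_toReal (ENNReal.sum_ne_top.2 hBne)).1
      (by rwa [ENNReal.ofReal_one])
  -- real bookkeeping: `Σ (c_x A_x + X_x) ≥ c₀ - c₀/2`
  have hmne : (t.card : ℝ) ≠ 0 := hm0.ne'
  have key : t.inf' htne c / 2 ≤ ∑ x ∈ t, (c x * A x + X x (f n)) := by
    have h1 : ∀ x ∈ t, t.inf' htne c * A x - t.inf' htne c / (2 * t.card) ≤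
        c x * A x + X x (f n) := fun x hx => by
      have hAx : 0 ≤ A x := by rw [hA]; exact integral_nonneg fun y => sq_nonneg _
      have hXx := abs_le.1 (hn x hx)
      nlinarith [hc₀le x hx, hXx.1]
    calc t.inf' htne c / 2
        = t.inf' htne c * 1 - t.card * (t.inf' htne c / (2 * t.card)) := by
          field_simp
          ring
      _ ≤ t.inf' htne c * (∑ x ∈ t, A x) - t.card * (t.inf' htne c / (2 * t.card)) :=
          sub_le_sub_right (mul_le_mul_of_nonneg_left hsumA hc₀.le) _
      _ = ∑ x ∈ t, (t.inf' htne c * A x - t.inf' htne c / (2 * t.card)) := by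
          rw [Finset.sum_sub_distrib, Finset.mul_sum, Finset.sum_const, nsmul_eq_mul]
      _ ≤ ∑ x ∈ t, (c x * A x + X x (f n)) := Finset.sum_le_sum h1
  -- sum the local estimates
  have step : ENNReal.ofReal (t.inf' htne c / 8) ≤ (t.card : ℝ≥0∞) * boltzmannForm ω₂ a b (f n) := by
    have e8 : ENNReal.ofReal (1 / 4) * ENNReal.ofReal (t.inf' htne c / 2) =
        ENNReal.ofReal (t.inf' htne c / 8) := by
      rw [← ENNReal.ofReal_mul (by norm_num)]
      congr 1
      ring
    calc ENNReal.ofReal (t.inf' htne c / 8)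
        = ENNReal.ofReal (1 / 4) * ENNReal.ofReal (t.inf' htne c / 2) := e8.symm
      _ ≤ ENNReal.ofReal (1 / 4) * ENNReal.ofReal (∑ x ∈ t, (c x * A x + X x (f n))) :=
          mul_le_mul' le_rfl (ENNReal.ofReal_le_ofReal key)
      _ ≤ ENNReal.ofReal (1 / 4) * ∑ x ∈ t, ENNReal.ofReal (c x * A x + X x (f n)) :=
          mul_le_mul' le_rfl (ofReal_sum_le _ _)
      _ = ∑ x ∈ t, ENNReal.ofReal (1 / 4) * ENNReal.ofReal (c x * A x + X x (f n)) :=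
          Finset.mul_sum _ _ _
      _ ≤ ∑ x ∈ t, boltzmannForm ω₂ a b (f n) := Finset.sum_le_sum hX1'
      _ = (t.card : ℝ≥0∞) * boltzmannForm ω₂ a b (f n) := by
          rw [Finset.sum_const, nsmul_eq_mul]
  calc ENNReal.ofReal (t.inf' htne c / (8 * t.card))
      = ENNReal.ofReal (t.inf' htne c / 8) / (t.card : ℝ≥0∞) := by
        rw [← div_div, ENNReal.ofReal_div_of_pos hm0, ENNReal.ofReal_natCast]
    _ ≤ boltzmannForm ω₂ a b (f n) := ENNReal.div_le_of_le_mul' step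

end Summit.AtomisticToContinuum.FouriersLaw.Theorems.FGRGap.FoldJetRigidity.EssGap

namespace Summit.AtomisticToContinuum.FouriersLaw.Theorems.FGRGap.FoldJetRigidity

open EssGap in
/-- REGISTERED STUB `stub_oddEssentialGap` of the line fold-jet-rigidity for the crux `FGRGap`
(item `stmt-AtomisticToContinuum-12595`): the ODD-SECTOR ESSENTIAL GAP. Given the partner-map bundle (GA)
and fibre genericity (GB), for `a > 0`, `b ≥ 0` there is `v₀ > 0` with `liminf q(f_n) ≥ v₀` along every
weakly-null sequence of odd, `2π`-periodic, measurable unit vectors `f_n`. Proof: parts A–G give the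
local estimate at every base momentum; part H (`oddEssentialGap_of_local`) assembles it over a finite
subcover of `[-π, π]`. [folklore] -/
theorem stub_oddEssentialGap :
    ∀ ω₂ : ℝ, 0 < ω₂ → ∀ h : ℝ → ℝ → ℝ,
      ((∀ k₁ k₃ : ℝ, h k₁ k₃ ∈ Set.Ioc (-π) π) ∧
        (∀ k₁ k₃ : ℝ, resonanceFn ω₂ k₁ (h k₁ k₃) k₃ = 0) ∧
        (∀ k₁ k₃ : ℝ, h (k₁ + 2 * π) k₃ = h k₁ k₃ ∧ h k₁ (k₃ + 2 * π) = h k₁ k₃) ∧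
        (∀ k : ℝ, k ∈ Set.Ioc (-π) π → h k k = k) ∧
        (∀ k₁ k₃ : ℝ, (∀ n : ℤ, k₃ - k₁ ≠ n * (2 * π)) →
          resonantSet ω₂ k₁ k₃ = {toIocMod Real.two_pi_pos (-π) k₃, h k₁ k₃}) ∧
        (∀ k₁ k₃ : ℝ, (∀ n : ℤ, k₃ - k₁ ≠ n * (2 * π)) →
          (h k₁ k₃ = toIocMod Real.two_pi_pos (-π) k₃ ↔ groupVelocity ω₂ k₃ = groupVelocity ω₂ k₁)) ∧
        (∀ k₁ k₃ : ℝ, groupVelocity ω₂ k₃ ≠ groupVelocity ω₂ k₁ →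
          groupVelocity ω₂ (h k₁ k₃) ≠ groupVelocity ω₂ (k₁ + h k₁ k₃ - k₃)) ∧
        Measurable (Function.uncurry h) ∧
        (∀ k₁ k₃ : ℝ, groupVelocity ω₂ k₃ ≠ groupVelocity ω₂ k₁ →
          ∃ (φ : ℝ × ℝ → ℝ) (U : Set (ℝ × ℝ)), U ∈ 𝓝 (k₁, k₃) ∧ AnalyticOnNhd ℝ φ U ∧
            φ (k₁, k₃) = h k₁ k₃ ∧ (∀ p ∈ U, ∃ n : ℤ, φ p = h p.1 p.2 + n * (2 * π)) ∧
            (∀ p ∈ U, groupVelocity ω₂ p.2 ≠ groupVelocity ω₂ p.1) ∧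
            (∀ p ∈ U, HasStrictFDerivAt φ (((groupVelocity ω₂ (p.1 + φ p - p.2) - groupVelocity ω₂ p.1) /
              (groupVelocity ω₂ (φ p) - groupVelocity ω₂ (p.1 + φ p - p.2))) • ContinuousLinearMap.fst ℝ ℝ ℝ +
            ((groupVelocity ω₂ p.2 - groupVelocity ω₂ (p.1 + φ p - p.2)) /
              (groupVelocity ω₂ (φ p) - groupVelocity ω₂ (p.1 + φ p - p.2))) • ContinuousLinearMap.snd ℝ ℝ ℝ) p))) →
      ((∀ k₁ r : ℝ, 0 ≤ r → ∃ k₃ : ℝ,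
          groupVelocity ω₂ k₁ ≠ groupVelocity ω₂ (h k₁ k₃) ∧ groupVelocity ω₂ k₁ ≠ groupVelocity ω₂ k₃ ∧
          groupVelocity ω₂ k₁ ≠ groupVelocity ω₂ (k₁ + h k₁ k₃ - k₃) ∧ groupVelocity ω₂ (h k₁ k₃) ≠ groupVelocity ω₂ k₃ ∧
          groupVelocity ω₂ (h k₁ k₃) ≠ groupVelocity ω₂ (k₁ + h k₁ k₃ - k₃) ∧ groupVelocity ω₂ k₃ ≠ groupVelocity ω₂ (k₁ + h k₁ k₃ - k₃) ∧
          vertex 1 r k₁ (h k₁ k₃) k₃ ≠ 0) ∧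
        MeasureTheory.volume {p : ℝ × ℝ | groupVelocity ω₂ p.2 = groupVelocity ω₂ p.1} = 0 ∧
        (∀ a b : ℝ, 0 < a → 0 ≤ b →
          MeasureTheory.volume {p : ℝ × ℝ | vertex a b p.1 (h p.1 p.2) p.2 = 0} = 0)) →
      ∀ a b : ℝ, 0 < a → 0 ≤ b →
        (∃ v₀ : ℝ, 0 < v₀ ∧
          ∀ f : ℕ → ℝ → ℝ, (∀ n, Function.Periodic (f n) (2 * π)) → (∀ n, Measurable (f n)) →
            (∀ n, Function.Odd (f n)) → (∀ n, cellNormSq (f n) = 1) →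
              (∀ φ : ℝ → ℝ, Measurable φ → cellNormSq φ < ∞ →
                  Filter.Tendsto (fun n => cellPairing φ (f n)) Filter.atTop (nhds 0)) →
                ENNReal.ofReal v₀ ≤ Filter.liminf (fun n => boltzmannForm ω₂ a b (f n)) Filter.atTop) := by
  intro ω₂ hω h hB hC a b ha hb
  obtain ⟨-, hres, hperh, -, htwo, -, -, -, hloc⟩ := hB
  obtain ⟨hgp, -, -⟩ := hC
  exact oddEssentialGap_of_local fun x₀ =>
    local_estimate hω hres hperh htwo hloc
      (fun k₁ r hr => by
        obtain ⟨k₃, h1, h2, h3, h4, h5, h6, h7⟩ := hgp k₁ r hr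
        exact ⟨k₃, ⟨h1, h2, h3, h4, h5, h6⟩, h7⟩) ha hb x₀

end Summit.AtomisticToContinuum.FouriersLaw.Theorems.FGRGap.FoldJetRigidity

end
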